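import Summits.BirchSwinnertonDyer.BirchSwinnertonDyer.Theorems.SylvesterTwoHeegnerIndexCMHalfDecompositionAtThree
import Summits.BirchSwinnertonDyer.BirchSwinnertonDyer.Theorems.SylvesterTwoHeegnerIndexCMHalfCruxOfTails
import HarnessLib

/-!
# (S10b) of leaf (L1) at `p ≡ 7 (mod 9)`, crux `UpperOffV0HSYPlus` (stmt-BirchSwinnertonDyer-19804): `stub_layerL1Seven`
# (and the crux modulo the tails) WITH THE LOCAL TOWER-FIXING CLAUSE REPLACED BY «`φ_n` IS AN INVOLUTION IN THE
# DECOMPOSITION GROUP AT `w ∣ 3`»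

Skeleton VARIANT M 406ca288e244d392; planner D531 (3) (successor task #S10, no veto in advance on a clean census; planner
byte-check vs `stub_layerL1Seven` l.104–152).  #S9c (p685405) displays the TOWER FIXING `hTF` (cell lemma W2, memo two
§67.2) with, at every Kolyvagin level `n` and every `v ∣ 3`, an `∃ Φ ≤ Γ_{K_v}` clause (open, odd index, acting on the
embedded `K[9pn]` through `{1, φ_n}`).  By #S10a (`exists_oddIndex_localFixer`: the image of `Γ_{K_v}` in `Gal(K[9pn]/K)` has
order dividing `18`) that clause FOLLOWS from the purely descriptive datum

  (TF′-loc)  `φ_n * φ_n = 1` and, for each `v ∣ 3`, SOME `τ ∈ Γ_{K_v}` acts on `e(K[9pn])` as `φ_n`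

(«`φ_n` is an involution lying in the decomposition group»; in the memo `φ_n = Art_w(ϖ_w)⁹`-type, the unique involution
of `D_w ≅ ℤ/18`), the GLOBAL clauses (`s ≠ 1` involution of `K[9p]/K` fixing `∛3, ∛p, y₁`; `φ_n` restricts to `s` and fixes
`y_n`) being unchanged.  So the displayed hypothesis shrinks to `hTF′` = #S9c's `hTF` with its last five lines (the
`∃ Φ` clause) replaced by (TF′-loc) — pure Shimura-reciprocity content, the CFT half now a tree theorem.

* `towerFixing_of_decompFixing (Dt) : hTF′ → hTF` (#S10a at each level; `φ_n ≠ 1` because it restricts to `s ≠ 1`;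
  `3 ∤ n` because every prime factor of `n` is `≡ 2 (mod 3)`);
* **`layerL1Seven_of_named_of_flip_of_decompFixing (Dt) (hdeg) (hD) (hES2) (hTF′)` : ⟨`stub_layerL1Seven`'s type VERBATIM⟩**
  (= p685405 ∘ the above);
* `upperOffV0HSYPlus_of_named_of_flip_of_decompFixing_of_tails (Dt) (hdeg) (hD) (hES2) (hTF′) (htailFour) (htailSeven) :
  Theses.SylvesterTwoHeegnerIndex.UpperOffV0HSYPlus` (= #U p687626 ∘ the above; the kernel census with the slimmer `hTF′`).

HONEST LABEL: CONDITIONAL closures; `hTF′` is still the unrefereed cell lemma W2 (memo two §67.2 (W2-a/b): Shimura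
reciprocity on `X₀(243)`, desk (M-K3-7)); the tails are OPEN stubs displayed as hypotheses; the ledger stub is NOT closed;
items 19802/19804 stay OPEN; X12.CMAtTwo NOT proved; BSD is not proved by any of this, for any curve.
`--supports stmt-BirchSwinnertonDyer-19804 --as helper`.
-/

set_option linter.dupNamespace false
set_option autoImplicit false

noncomputable section

open scoped Classical Pointwise

namespace Summit.BirchSwinnertonDyer.BirchSwinnertonDyer.Theorems.SylvesterTwoCMHalf

open WeierstrassCurve Field NumberField IsDedekindDomain Finset
open Literature.NumberTheory.EllipticCurves Literature.NumberTheory.GaloisRepresentations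
  Literature.NumberTheory.EllipticCurves.ModularForms
  Literature.NumberTheory.EllipticCurves.HuShuYin2019
  Literature.NumberTheory.EllipticCurves.KolyvaginCocycle
  Literature.NumberTheory.EllipticCurves.RingClassField
  Summit.BirchSwinnertonDyer.BirchSwinnertonDyer.Theses.SylvesterTwoHeegnerIndex
  Summit.BirchSwinnertonDyer.BirchSwinnertonDyer.Theorems
  Summit.BirchSwinnertonDyer.BirchSwinnertonDyer.Theorems.SylvesterTwoCoupledDescentCebotarev
  Summit.BirchSwinnertonDyer.BirchSwinnertonDyer.Theorems.SylvesterTwoCMData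
  Summit.BirchSwinnertonDyer.BirchSwinnertonDyer.Theorems.SylvesterTwoCMFlip
  Summit.BirchSwinnertonDyer.Rank1Residual.X11b Summit.BirchSwinnertonDyer.Rank1Residual.X11b.RingClassTower

set_option maxHeartbeats 800000 in
/-- **`hTF′ → hTF`: the LOCAL `∃ Φ` clause of #S9c's tower fixing from «`φ_n` is an involution in the decomposition
group»** (#S10a `exists_oddIndex_localFixer` at each Kolyvagin level; `φ_n ≠ 1` since it restricts to `s ≠ 1`).
[cite: NeukirchANT1999, Ch. II §9 Prop. (9.6)] [cite: HuShuYin2019, §2.2 Prop. 2.4 (1), §4.1 p. 10] [cite: GrossLMS1991, §3] -/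
theorem towerFixing_of_decompFixing
    (Dt : ModularParametrizationData (⟨0, 0, 1, 0, -1⟩ : WeierstrassCurve ℚ) 243)
    (hTF' : ∀ (p : ℕ), p.Prime → p % 9 = 7 → ∀ (K : Type) [Field K] [NumberField K] (ω : K), ω ^ 2 + ω + 1 = 0 →
      Module.finrank ℚ K = 2 → ∀ (ι : K →+* ℂ) (c₃ cp : ringClassField K ι (9 * p)), c₃ ^ 3 = 3 →
      cp ^ 3 = (p : ringClassField K ι (9 * p)) →
      ∀ (y₁ : ((⟨0, 0, 1, 0, -1⟩ : WeierstrassCurve ℚ).baseChange (ringClassField K ι (9 * p))).toAffine.Point),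
        Affine.Point.map (W' := (⟨0, 0, 1, 0, -1⟩ : WeierstrassCurve ℚ)) (ringClassField K ι (9 * p)).subtype.toRatAlgHom y₁ =
          Dt.φ (heegnerTau (81 * ((p : ℤ) ^ 2 + 4 * p + 16), -(9 * (4 * (p : ℤ) ^ 2 + 17 * p + 72)), 4 * (p : ℤ) ^ 2 + 18 * p + 81)) →
      ∃ s : ringClassField K ι (9 * p) ≃ₐ[K] ringClassField K ι (9 * p), s ≠ 1 ∧ s * s = 1 ∧ s c₃ = c₃ ∧ s cp = cp ∧
        pointGalHom (⟨0, 0, 1, 0, -1⟩ : WeierstrassCurve ℚ) (ringClassField K ι (9 * p)) (s.restrictScalars ℚ) y₁ = y₁ ∧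
        ∀ (n : ℕ), n ≠ 0 → (∀ q ∈ n.primeFactors, q % 3 = 2) →
          ∀ (hle : ringClassField K ι (9 * p) ≤ ringClassField K ι (9 * p * n))
            (e : ringClassField K ι (9 * p * n) →+* AlgebraicClosure K),
            (∀ k : K, e (algebraMap K (ringClassField K ι (9 * p * n)) k) = algebraMap K (AlgebraicClosure K) k) →
          ∀ (y : ((⟨0, 0, 1, 0, -1⟩ : WeierstrassCurve ℚ).baseChange (ringClassField K ι (9 * p * n))).toAffine.Point),
            Affine.Point.map (W' := (⟨0, 0, 1, 0, -1⟩ : WeierstrassCurve ℚ)) (ringClassField K ι (9 * p * n)).subtype.toRatAlgHom y =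
              Dt.φ (heegnerTau ((n : ℤ) ^ 2 * (81 * ((p : ℤ) ^ 2 + 4 * p + 16)),
                (n : ℤ) * (-(9 * (4 * (p : ℤ) ^ 2 + 17 * p + 72))), 4 * (p : ℤ) ^ 2 + 18 * p + 81)) →
          ∃ φ : ringClassField K ι (9 * p * n) ≃ₐ[K] ringClassField K ι (9 * p * n),
            (∀ x : ringClassField K ι (9 * p), φ (RingClassField.inclusion ι hle x) = RingClassField.inclusion ι hle (s x)) ∧
            pointGalHom (⟨0, 0, 1, 0, -1⟩ : WeierstrassCurve ℚ) (ringClassField K ι (9 * p * n)) (φ.restrictScalars ℚ) y = y ∧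
            φ * φ = 1 ∧
            ∀ (v : HeightOneSpectrum (𝓞 K)), ((3 : ℕ) : 𝓞 K) ∈ v.asIdeal →
              ∃ τ : absoluteGaloisGroup (v.adicCompletion K),
                ∀ x : ringClassField K ι (9 * p * n), (show AlgebraicClosure K ≃ₐ[K] AlgebraicClosure K from
                  resGal (K := K) (v.adicCompletion K) τ) (e x) = e (φ x)) :
    ∀ (p : ℕ), p.Prime → p % 9 = 7 → ∀ (K : Type) [Field K] [NumberField K] (ω : K), ω ^ 2 + ω + 1 = 0 →
      Module.finrank ℚ K = 2 → ∀ (ι : K →+* ℂ) (c₃ cp : ringClassField K ι (9 * p)), c₃ ^ 3 = 3 →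
      cp ^ 3 = (p : ringClassField K ι (9 * p)) →
      ∀ (y₁ : ((⟨0, 0, 1, 0, -1⟩ : WeierstrassCurve ℚ).baseChange (ringClassField K ι (9 * p))).toAffine.Point),
        Affine.Point.map (W' := (⟨0, 0, 1, 0, -1⟩ : WeierstrassCurve ℚ)) (ringClassField K ι (9 * p)).subtype.toRatAlgHom y₁ =
          Dt.φ (heegnerTau (81 * ((p : ℤ) ^ 2 + 4 * p + 16), -(9 * (4 * (p : ℤ) ^ 2 + 17 * p + 72)), 4 * (p : ℤ) ^ 2 + 18 * p + 81)) →
      ∃ s : ringClassField K ι (9 * p) ≃ₐ[K] ringClassField K ι (9 * p), s ≠ 1 ∧ s * s = 1 ∧ s c₃ = c₃ ∧ s cp = cp ∧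
        pointGalHom (⟨0, 0, 1, 0, -1⟩ : WeierstrassCurve ℚ) (ringClassField K ι (9 * p)) (s.restrictScalars ℚ) y₁ = y₁ ∧
        ∀ (n : ℕ), n ≠ 0 → (∀ q ∈ n.primeFactors, q % 3 = 2) →
          ∀ (hle : ringClassField K ι (9 * p) ≤ ringClassField K ι (9 * p * n))
            (e : ringClassField K ι (9 * p * n) →+* AlgebraicClosure K),
            (∀ k : K, e (algebraMap K (ringClassField K ι (9 * p * n)) k) = algebraMap K (AlgebraicClosure K) k) →
          ∀ (y : ((⟨0, 0, 1, 0, -1⟩ : WeierstrassCurve ℚ).baseChange (ringClassField K ι (9 * p * n))).toAffine.Point),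
            Affine.Point.map (W' := (⟨0, 0, 1, 0, -1⟩ : WeierstrassCurve ℚ)) (ringClassField K ι (9 * p * n)).subtype.toRatAlgHom y =
              Dt.φ (heegnerTau ((n : ℤ) ^ 2 * (81 * ((p : ℤ) ^ 2 + 4 * p + 16)),
                (n : ℤ) * (-(9 * (4 * (p : ℤ) ^ 2 + 17 * p + 72))), 4 * (p : ℤ) ^ 2 + 18 * p + 81)) →
          ∃ φ : ringClassField K ι (9 * p * n) ≃ₐ[K] ringClassField K ι (9 * p * n),
            (∀ x : ringClassField K ι (9 * p), φ (RingClassField.inclusion ι hle x) = RingClassField.inclusion ι hle (s x)) ∧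
            pointGalHom (⟨0, 0, 1, 0, -1⟩ : WeierstrassCurve ℚ) (ringClassField K ι (9 * p * n)) (φ.restrictScalars ℚ) y = y ∧
            ∀ (v : HeightOneSpectrum (𝓞 K)), ((3 : ℕ) : 𝓞 K) ∈ v.asIdeal →
              ∃ Φ : Subgroup (absoluteGaloisGroup (v.adicCompletion K)),
                IsOpen (Φ : Set (absoluteGaloisGroup (v.adicCompletion K))) ∧ IsCoprime (Φ.index : ℤ) ((2 : ℕ) : ℤ) ∧
                ∀ τ ∈ Φ, (∀ x : ringClassField K ι (9 * p * n), (show AlgebraicClosure K ≃ₐ[K] AlgebraicClosure K from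
                    resGal (K := K) (v.adicCompletion K) τ) (e x) = e x) ∨
                  (∀ x : ringClassField K ι (9 * p * n), (show AlgebraicClosure K ≃ₐ[K] AlgebraicClosure K from
                    resGal (K := K) (v.adicCompletion K) τ) (e x) = e (φ x)) := by
  intro p hp hp7 K _ _ ω hω h2 ι c₃ cp hc₃ hcp y₁ hy₁
  obtain ⟨s, hs1, hs2, hs3, hsp, hsy, hn⟩ := hTF' p hp hp7 K ω hω h2 ι c₃ cp hc₃ hcp y₁ hy₁
  refine ⟨s, hs1, hs2, hs3, hsp, hsy, fun n hn0 hq hle e he y hy ↦ ?_⟩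
  obtain ⟨φ, hφs, hφy, hφ2, hloc⟩ := hn n hn0 hq hle e he y hy
  refine ⟨φ, hφs, hφy, fun v hv ↦ ?_⟩
  obtain ⟨τ₀, hτ₀⟩ := hloc v hv
  have hφ1 : φ ≠ 1 := by
    intro h1
    apply hs1
    refine AlgEquiv.ext fun x ↦ (RingClassField.inclusion ι hle).injective ?_
    have hx := hφs x
    rw [h1, AlgEquiv.one_apply] at hx
    rw [AlgEquiv.one_apply]
    exact hx.symm
  have hn3 : ¬ 3 ∣ n := fun h3 ↦ by
    have := hq 3 (Nat.mem_primeFactors.mpr ⟨Nat.prime_three, h3, hn0⟩)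
    omega
  have hp3 : p % 3 = 1 := by omega
  exact exists_oddIndex_localFixer hω h2 ι hp hp3 hn0 hn3 v hv e he hφ1 hφ2 hτ₀

set_option maxHeartbeats 1600000 in
/-- **`stub_layerL1Seven` MODULO {`Dt` of degree 6, #19, #20} AND THE SLIM TOWER FIXING `hTF′`** (GLOBAL clauses + «`φ_n`
is an involution in the decomposition group at `w ∣ 3`»): the stub's statement VERBATIM (= p685405
`layerL1Seven_of_named_of_flip_of_fixing` fed with `towerFixing_of_decompFixing`).  CONDITIONAL; the ledger stub stays
open; BSD is not proved by any of this. [cite: HuShuYin2019, Thm. 1.4, §2 Prop. 2.4 / Cor. 2.5, §3 p. 8, §4.1]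
[cite: GrossLMS1991, §3–§6] [cite: Nekovar2007, Prop. 4.9] [cite: NeukirchANT1999, Ch. II §9 Prop. (9.6)] -/
theorem layerL1Seven_of_named_of_flip_of_decompFixing
    (Dt : ModularParametrizationData (⟨0, 0, 1, 0, -1⟩ : WeierstrassCurve ℚ) 243) (hdeg : Dt.deg = 6)
    (hD : shaAnPair_mul_height_eq_two_zpow_mul_height_named)
    (hES2 : Nekovar2007.cmPoint_frobeniusCongruence)
    (hTF' : ∀ (p : ℕ), p.Prime → p % 9 = 7 → ∀ (K : Type) [Field K] [NumberField K] (ω : K), ω ^ 2 + ω + 1 = 0 →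
      Module.finrank ℚ K = 2 → ∀ (ι : K →+* ℂ) (c₃ cp : ringClassField K ι (9 * p)), c₃ ^ 3 = 3 →
      cp ^ 3 = (p : ringClassField K ι (9 * p)) →
      ∀ (y₁ : ((⟨0, 0, 1, 0, -1⟩ : WeierstrassCurve ℚ).baseChange (ringClassField K ι (9 * p))).toAffine.Point),
        Affine.Point.map (W' := (⟨0, 0, 1, 0, -1⟩ : WeierstrassCurve ℚ)) (ringClassField K ι (9 * p)).subtype.toRatAlgHom y₁ =
          Dt.φ (heegnerTau (81 * ((p : ℤ) ^ 2 + 4 * p + 16), -(9 * (4 * (p : ℤ) ^ 2 + 17 * p + 72)), 4 * (p : ℤ) ^ 2 + 18 * p + 81)) →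
      ∃ s : ringClassField K ι (9 * p) ≃ₐ[K] ringClassField K ι (9 * p), s ≠ 1 ∧ s * s = 1 ∧ s c₃ = c₃ ∧ s cp = cp ∧
        pointGalHom (⟨0, 0, 1, 0, -1⟩ : WeierstrassCurve ℚ) (ringClassField K ι (9 * p)) (s.restrictScalars ℚ) y₁ = y₁ ∧
        ∀ (n : ℕ), n ≠ 0 → (∀ q ∈ n.primeFactors, q % 3 = 2) →
          ∀ (hle : ringClassField K ι (9 * p) ≤ ringClassField K ι (9 * p * n))
            (e : ringClassField K ι (9 * p * n) →+* AlgebraicClosure K),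
            (∀ k : K, e (algebraMap K (ringClassField K ι (9 * p * n)) k) = algebraMap K (AlgebraicClosure K) k) →
          ∀ (y : ((⟨0, 0, 1, 0, -1⟩ : WeierstrassCurve ℚ).baseChange (ringClassField K ι (9 * p * n))).toAffine.Point),
            Affine.Point.map (W' := (⟨0, 0, 1, 0, -1⟩ : WeierstrassCurve ℚ)) (ringClassField K ι (9 * p * n)).subtype.toRatAlgHom y =
              Dt.φ (heegnerTau ((n : ℤ) ^ 2 * (81 * ((p : ℤ) ^ 2 + 4 * p + 16)),
                (n : ℤ) * (-(9 * (4 * (p : ℤ) ^ 2 + 17 * p + 72))), 4 * (p : ℤ) ^ 2 + 18 * p + 81)) →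
          ∃ φ : ringClassField K ι (9 * p * n) ≃ₐ[K] ringClassField K ι (9 * p * n),
            (∀ x : ringClassField K ι (9 * p), φ (RingClassField.inclusion ι hle x) = RingClassField.inclusion ι hle (s x)) ∧
            pointGalHom (⟨0, 0, 1, 0, -1⟩ : WeierstrassCurve ℚ) (ringClassField K ι (9 * p * n)) (φ.restrictScalars ℚ) y = y ∧
            φ * φ = 1 ∧
            ∀ (v : HeightOneSpectrum (𝓞 K)), ((3 : ℕ) : 𝓞 K) ∈ v.asIdeal →
              ∃ τ : absoluteGaloisGroup (v.adicCompletion K),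
                ∀ x : ringClassField K ι (9 * p * n), (show AlgebraicClosure K ≃ₐ[K] AlgebraicClosure K from
                  resGal (K := K) (v.adicCompletion K) τ) (e x) = e (φ x)) :
    SylvesterTwoNonneg.HSYPointTwoDivisibleSevenModNine →
    (PublishedFactsTwoPlus →
      ∀ (p : ℕ), p.Prime → p % 9 = 7 → (¬ ∃ x : ZMod p, x ^ 3 = 3) →
        ∀ (A B : WeierstrassCurve ℚ) [A.IsElliptic] [A.IsGloballyMinimal] [B.IsElliptic]
          [B.IsGloballyMinimal], (∃ C : VariableChange ℚ, C • B = HuShuYin2019.cubeSumCurve (p : ℚ)) →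
          (∃ C : VariableChange ℚ, C • A = HuShuYin2019.cubeSumCurve (3 * (p : ℚ) ^ 2)) →
          ∀ (qB qA : ℚ), shaAn B = (qB : ℂ) → shaAn A = (qA : ℂ) → qB * qA ≠ 0 →
            padicValRat 2 (qB * qA) = 0 →
            ∀ (K : Type) [Field K] [NumberField K] (ω : K), ω ^ 2 + ω + 1 = 0 →
              Module.finrank ℚ K = 2 →
            ∀ Y₀ : ((cubeSumCurve (p : ℚ)).baseChange K).toAffine.Point,
              (¬ ∃ Q : ((cubeSumCurve (p : ℚ)).baseChange K).toAffine.Point, (2 : ℕ) • Q = Y₀) →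
            ∃ (cA : ℕ → galH1Torsion ((cubeSumCurve (3 * (p : ℚ) ^ 2)).baseChange K) (2 : ℕ))
              (cB : ℕ → galH1Torsion ((cubeSumCurve (p : ℚ)).baseChange K) (2 : ℕ)),
            (∀ ℓ, (ℓ.Prime ∧ ¬ ℓ ∣ (cubeSumCurve (3 * (p : ℚ) ^ 2)).conductorNorm ℤ ∧
                ¬ ℓ ∣ (cubeSumCurve (p : ℚ)).conductorNorm ℤ ∧ ¬ ((ℓ : ℤ) ∣ NumberField.discr K) ∧ ℓ ≠ 2 ∧
                (Ideal.span {(ℓ : 𝓞 K)}).IsPrime ∧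
                FrobEqFrobInfty (cubeSumCurve (3 * (p : ℚ) ^ 2)) K 2 ℓ ∧
                FrobEqFrobInfty (cubeSumCurve (p : ℚ)) K 2 ℓ) →
              (∀ v : HeightOneSpectrum (𝓞 K), (ℓ : 𝓞 K) ∉ v.asIdeal →
                cA ℓ ∈ selmerLocalKer ((cubeSumCurve (3 * (p : ℚ) ^ 2)).baseChange K)
                  (v.adicCompletion K) (2 : ℕ)) ∧
              (∀ x : InfinitePlace K, cA ℓ ∈ selmerLocalKer
                ((cubeSumCurve (3 * (p : ℚ) ^ 2)).baseChange K) x.Completion (2 : ℕ)) ∧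
              (∀ v : HeightOneSpectrum (𝓞 K), (ℓ : 𝓞 K) ∈ v.asIdeal →
                (cA ℓ ∈ selmerLocalKer ((cubeSumCurve (3 * (p : ℚ) ^ 2)).baseChange K)
                    (v.adicCompletion K) (2 : ℕ) ↔
                  kummerClassOfPoint (cubeSumCurve (p : ℚ)) K Nat.prime_two Y₀ ∈
                    ((cubeSumCurve (p : ℚ)).baseChange K).torsionLocalKer (v.adicCompletion K) (2 : ℕ)))) ∧
            (∀ ℓ ℓ', (ℓ.Prime ∧ ¬ ℓ ∣ (cubeSumCurve (3 * (p : ℚ) ^ 2)).conductorNorm ℤ ∧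
                ¬ ℓ ∣ (cubeSumCurve (p : ℚ)).conductorNorm ℤ ∧ ¬ ((ℓ : ℤ) ∣ NumberField.discr K) ∧ ℓ ≠ 2 ∧
                (Ideal.span {(ℓ : 𝓞 K)}).IsPrime ∧
                FrobEqFrobInfty (cubeSumCurve (3 * (p : ℚ) ^ 2)) K 2 ℓ ∧
                FrobEqFrobInfty (cubeSumCurve (p : ℚ)) K 2 ℓ) →
              (ℓ'.Prime ∧ ¬ ℓ' ∣ (cubeSumCurve (3 * (p : ℚ) ^ 2)).conductorNorm ℤ ∧
                ¬ ℓ' ∣ (cubeSumCurve (p : ℚ)).conductorNorm ℤ ∧ ¬ ((ℓ' : ℤ) ∣ NumberField.discr K) ∧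
                ℓ' ≠ 2 ∧ (Ideal.span {(ℓ' : 𝓞 K)}).IsPrime ∧
                FrobEqFrobInfty (cubeSumCurve (3 * (p : ℚ) ^ 2)) K 2 ℓ' ∧
                FrobEqFrobInfty (cubeSumCurve (p : ℚ)) K 2 ℓ') → ℓ ≠ ℓ' →
              (∀ v : HeightOneSpectrum (𝓞 K), (ℓ : 𝓞 K) ∉ v.asIdeal → (ℓ' : 𝓞 K) ∉ v.asIdeal →
                cB (ℓ * ℓ') ∈ selmerLocalKer ((cubeSumCurve (p : ℚ)).baseChange K)
                  (v.adicCompletion K) (2 : ℕ)) ∧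
              (∀ x : InfinitePlace K,
                cB (ℓ * ℓ') ∈ selmerLocalKer ((cubeSumCurve (p : ℚ)).baseChange K) x.Completion (2 : ℕ)) ∧
              (∀ v : HeightOneSpectrum (𝓞 K), (ℓ : 𝓞 K) ∈ v.asIdeal →
                (cB (ℓ * ℓ') ∈ selmerLocalKer ((cubeSumCurve (p : ℚ)).baseChange K)
                    (v.adicCompletion K) (2 : ℕ) ↔
                  cA ℓ' ∈ ((cubeSumCurve (3 * (p : ℚ) ^ 2)).baseChange K).torsionLocalKer
                    (v.adicCompletion K) (2 : ℕ))))) :=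
  layerL1Seven_of_named_of_flip_of_fixing Dt hdeg hD hES2 (towerFixing_of_decompFixing Dt hTF')

/-- **THE CRUX `UpperOffV0HSYPlus` BY NAME, MODULO {`Dt` of degree 6, #19, #20, the SLIM tower fixing `hTF′`} AND THE TWO
TAIL STUBS** (#U `upperOffV0HSYPlus_of_named_of_flip_of_fixing_of_tails` fed with `towerFixing_of_decompFixing`).  A census
in the kernel: CONDITIONAL; item 19804 stays OPEN; BSD is not proved by any of this, for any curve.
[cite: HuShuYin2019, Thm. 1.4, Cor. 4.4] [cite: GrossLMS1991, §3–§6] [cite: Kolyvagin1990, §2] [cite: Nekovar2007, Prop. 4.9] -/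
theorem upperOffV0HSYPlus_of_named_of_flip_of_decompFixing_of_tails
    (Dt : ModularParametrizationData (⟨0, 0, 1, 0, -1⟩ : WeierstrassCurve ℚ) 243) (hdeg : Dt.deg = 6)
    (hD : shaAnPair_mul_height_eq_two_zpow_mul_height_named)
    (hES2 : Nekovar2007.cmPoint_frobeniusCongruence)
    (hTF' : ∀ (p : ℕ), p.Prime → p % 9 = 7 → ∀ (K : Type) [Field K] [NumberField K] (ω : K), ω ^ 2 + ω + 1 = 0 →
      Module.finrank ℚ K = 2 → ∀ (ι : K →+* ℂ) (c₃ cp : ringClassField K ι (9 * p)), c₃ ^ 3 = 3 →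
      cp ^ 3 = (p : ringClassField K ι (9 * p)) →
      ∀ (y₁ : ((⟨0, 0, 1, 0, -1⟩ : WeierstrassCurve ℚ).baseChange (ringClassField K ι (9 * p))).toAffine.Point),
        Affine.Point.map (W' := (⟨0, 0, 1, 0, -1⟩ : WeierstrassCurve ℚ)) (ringClassField K ι (9 * p)).subtype.toRatAlgHom y₁ =
          Dt.φ (heegnerTau (81 * ((p : ℤ) ^ 2 + 4 * p + 16), -(9 * (4 * (p : ℤ) ^ 2 + 17 * p + 72)), 4 * (p : ℤ) ^ 2 + 18 * p + 81)) →
      ∃ s : ringClassField K ι (9 * p) ≃ₐ[K] ringClassField K ι (9 * p), s ≠ 1 ∧ s * s = 1 ∧ s c₃ = c₃ ∧ s cp = cp ∧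
        pointGalHom (⟨0, 0, 1, 0, -1⟩ : WeierstrassCurve ℚ) (ringClassField K ι (9 * p)) (s.restrictScalars ℚ) y₁ = y₁ ∧
        ∀ (n : ℕ), n ≠ 0 → (∀ q ∈ n.primeFactors, q % 3 = 2) →
          ∀ (hle : ringClassField K ι (9 * p) ≤ ringClassField K ι (9 * p * n))
            (e : ringClassField K ι (9 * p * n) →+* AlgebraicClosure K),
            (∀ k : K, e (algebraMap K (ringClassField K ι (9 * p * n)) k) = algebraMap K (AlgebraicClosure K) k) →
          ∀ (y : ((⟨0, 0, 1, 0, -1⟩ : WeierstrassCurve ℚ).baseChange (ringClassField K ι (9 * p * n))).toAffine.Point),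
            Affine.Point.map (W' := (⟨0, 0, 1, 0, -1⟩ : WeierstrassCurve ℚ)) (ringClassField K ι (9 * p * n)).subtype.toRatAlgHom y =
              Dt.φ (heegnerTau ((n : ℤ) ^ 2 * (81 * ((p : ℤ) ^ 2 + 4 * p + 16)),
                (n : ℤ) * (-(9 * (4 * (p : ℤ) ^ 2 + 17 * p + 72))), 4 * (p : ℤ) ^ 2 + 18 * p + 81)) →
          ∃ φ : ringClassField K ι (9 * p * n) ≃ₐ[K] ringClassField K ι (9 * p * n),
            (∀ x : ringClassField K ι (9 * p), φ (RingClassField.inclusion ι hle x) = RingClassField.inclusion ι hle (s x)) ∧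
            pointGalHom (⟨0, 0, 1, 0, -1⟩ : WeierstrassCurve ℚ) (ringClassField K ι (9 * p * n)) (φ.restrictScalars ℚ) y = y ∧
            φ * φ = 1 ∧
            ∀ (v : HeightOneSpectrum (𝓞 K)), ((3 : ℕ) : 𝓞 K) ∈ v.asIdeal →
              ∃ τ : absoluteGaloisGroup (v.adicCompletion K),
                ∀ x : ringClassField K ι (9 * p * n), (show AlgebraicClosure K ≃ₐ[K] AlgebraicClosure K from
                  resGal (K := K) (v.adicCompletion K) τ) (e x) = e (φ x))
    (htailFour : PublishedFactsTwoPlus →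
    ∀ (p : ℕ), p.Prime → p % 9 = 4 → (¬ ∃ x : ZMod p, x ^ 3 = 3) →
      ∀ (A B : WeierstrassCurve ℚ) [A.IsElliptic] [A.IsGloballyMinimal] [B.IsElliptic]
        [B.IsGloballyMinimal], (∃ C : VariableChange ℚ, C • B = HuShuYin2019.cubeSumCurve (p : ℚ)) →
        (∃ C : VariableChange ℚ, C • A = HuShuYin2019.cubeSumCurve (3 * (p : ℚ) ^ 2)) →
        4 < Nat.card (AddCommGroup.primaryComponent B.sha 2) *
            Nat.card (AddCommGroup.primaryComponent A.sha 2) →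
        ∃ qB qA : ℚ, shaAn B = (qB : ℂ) ∧ shaAn A = (qA : ℂ) ∧ qB * qA ≠ 0 ∧
          (padicValNat 2 (Nat.card (AddCommGroup.primaryComponent B.sha 2)) : ℤ) +
              (padicValNat 2 (Nat.card (AddCommGroup.primaryComponent A.sha 2)) : ℤ) ≤
            padicValRat 2 (qB * qA))
    (htailSeven : PublishedFactsTwoPlus →
    ∀ (p : ℕ), p.Prime → p % 9 = 7 → (¬ ∃ x : ZMod p, x ^ 3 = 3) →
      ∀ (A B : WeierstrassCurve ℚ) [A.IsElliptic] [A.IsGloballyMinimal] [B.IsElliptic]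
        [B.IsGloballyMinimal], (∃ C : VariableChange ℚ, C • B = HuShuYin2019.cubeSumCurve (p : ℚ)) →
        (∃ C : VariableChange ℚ, C • A = HuShuYin2019.cubeSumCurve (3 * (p : ℚ) ^ 2)) →
        4 < Nat.card (AddCommGroup.primaryComponent B.sha 2) *
            Nat.card (AddCommGroup.primaryComponent A.sha 2) →
        ∃ qB qA : ℚ, shaAn B = (qB : ℂ) ∧ shaAn A = (qA : ℂ) ∧ qB * qA ≠ 0 ∧
          (padicValNat 2 (Nat.card (AddCommGroup.primaryComponent B.sha 2)) : ℤ) +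
              (padicValNat 2 (Nat.card (AddCommGroup.primaryComponent A.sha 2)) : ℤ) ≤
            padicValRat 2 (qB * qA)) :
    Summit.BirchSwinnertonDyer.BirchSwinnertonDyer.Theses.SylvesterTwoHeegnerIndex.UpperOffV0HSYPlus :=
  upperOffV0HSYPlus_of_named_of_flip_of_fixing_of_tails Dt hdeg hD hES2 (towerFixing_of_decompFixing Dt hTF')
    htailFour htailSeven

end Summit.BirchSwinnertonDyer.BirchSwinnertonDyer.Theorems.SylvesterTwoCMHalf

end
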